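/-
Copyright (c) 2026 the pub-hodgecm2 formalisation cell (harness21).  New file, outside the frozen port manifest.
Origin: seat `prover-pub-hodgecm2-d2bridge-socket-1-g0-0` (SOCKET-SPEC seat), 2026-08-23; the theorem body is end-1's END §A
(`PortJoin/ClosedPrinted.lean` v6 fdfcda659219, `thm418C_indexOfRecord_of_pins`) VERBATIM with the five (c)(d) binder families replaced by
ONE socket value `S : SocketCD F h6 V a₀ h Φ` (✔∕pending p372458 `CorCM/D2Bridge/SocketCD.lean`).  KERNEL lane: one theorem, no `def`, no
instance, no named fact, no `sorry`.  HC_CM is NOT proved; NOT «Δ2 BRIDGE CLOSED»; hLiu = READING r8; no inhabitant of the socket is claimed.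
-/
import Summits.HodgeConjecture.CorCM.D2Bridge.SocketCD
import Summits.HodgeConjecture.CorCM.PortJoin.HMDischargeLocal
import Summits.HodgeConjecture.CorCM.D2Bridge.PinSignatures
import Summits.HodgeConjecture.CorCM.B01.Transposition.Item6UniformOmegaRep
import Summits.HodgeConjecture.CorCM.D2Bridge.OmegaAtDeltaPrime
import Literature.NumberTheory.GelbartRogawski1991.UnitaryDualPairThetaKernelCMKTypeFin
import Literature.NumberTheory.Automorphic.Liu2021.AppendixC.Prop413DataOfRestOne
import Literature.NumberTheory.Automorphic.Liu2021.AppendixC.UniformOmegaCiteLegs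
import Literature.NumberTheory.Automorphic.Liu2021.Def45RMuFormSupply
import Literature.AlgebraicGeometry.ComplexMultiplication.CMAbelianVarietyRealisedHolds
import HarnessLib

set_option autoImplicit false

/-!
# The plug: END §A with (c)+(d) := ONE socket value

`thm418C_indexOfRecord_of_socket … (hbad) (hΩ) (hLiu') (h411) (h413) (hμsep) (hD1') (S : SocketCD F h6 V a₀ h Φ) : (𝔇).Thm418C` —
`Thm418C` of the pinned dictionary of record at a Galois CM field `F`, `6 ≤ [F:ℚ]`, from the displayed printed cites and the by-name pins,
with the J record and the pieces drawn from the socket: `M := S.M, jH := S.jH, hjHinj := S.hjHinj, hjH := S.hjH, pieces := S.pieces`.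
One `obtain` + ONE application of ✔ `PinSignatures.thm418C_liuDictionaryPin_of_pins`, the cite families transported from Liu's δ′ rest
`restOfCharDeltaPrime …` to the pin theorem's currency along `restOfCharRep_eq_rest` (`eR ▸`, never by definitional unfolding).
-/

noncomputable section

open scoped TensorProduct Matrix

namespace Summit.HodgeConjecture.CorCM.D2Bridge

open NumberField NumberField.InfinitePlace
open HodgeCM.Model HodgeCM.Model.LiuIndex HodgeCM.Model.TowerCarrier
open HodgeCM.Literature.Theta.LiuAlbaneseModuleDatum.D2Bridge (HcmPieces)
open Summit.HodgeConjecture.CorCM.Model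
open Literature.AlgebraicGeometry.Motives (CMType)
open Literature.AlgebraicGeometry.HodgeTheory Literature.NumberTheory.Automorphic.PicardCM
open Literature.AlgebraicGeometry.ShimuraVarieties.UnitaryCanonicalModel
open Literature.NumberTheory.ComplexMultiplication
open Literature.NumberTheory.Automorphic
open Literature.NumberTheory.Automorphic.IdeleClassGroup (toHeckeCharacter isUnitary_toHeckeCharacter)
open Literature.NumberTheory.Automorphic.Liu2021 Literature.NumberTheory.Automorphic.Liu2021.AppendixC
open Literature.NumberTheory.Automorphic.Liu2021.AppendixC.RestOne
open Literature.NumberTheory.Automorphic.Liu2021.Def411WeilCarriers (lineOf locF Rep)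
open Summit.HodgeConjecture.CorCM.Transposition.OmegaTransport (realUnit)
open HodgeCM.Model.ArchSideTerm (e₁)
open Literature.NumberTheory.GelbartRogawski1991 Literature.NumberTheory.GelbartRogawski1991.UnitaryDualPair
open Literature.NumberTheory.GelbartRogawski1991.UnitaryDualPair.LocalSplitting (localMu norm_localMu continuous_localMu localMu_toLocalRing_eq_one_iff)
open Literature.RepresentationTheory Literature.RepresentationTheory.Liu2021
open Summit.HodgeConjecture.CorCM.Transposition


/-! ### Notation (local, no declarations) — end-1 v6 VERBATIM -/

set_option quotPrecheck false
/-- the PINNED DICTIONARY OF RECORD at `(V, ι₁, a₀)` over the five `_holds` rows (the `h418` binder's dictionary, ✔ `PortJoin/Closed.lean`). -/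
local notation "𝔇⟦" V "," ι₁ "," a₀ "⟧" =>
  liuDictionaryPin exists_isReal_hodgeModel_holds hodgePQ_independent_of_hodgeModel_holds BallQuotient.ballQuotientUniformised_holds
    (cmAbelianVarietyRealised_of_eigenbasis exists_isReal_hodgeModel_holds hodgePQ_independent_of_hodgeModel_holds
      cmAbelianVarietyEigenbasisRealised_holds)
    Literature.NumberTheory.Transcendental.arapura2012_cor_15_4_6_holds V (I V (repAt a₀) (muLiu ι₁ GramClass.rep))
    (line V (repAt a₀) (muLiu ι₁ GramClass.rep))
/-- the App-C standing datum of record `sec42DataOf h isoOf F ι₁ V Φ` ([Liu21, §4.2 ∕ App. C]) at the ported codes. -/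
local notation "ℭ⟦" h "," F "," ι₁ "," V "," Φ "⟧" =>
  sec42DataOf h isoOf ⟨HodgeCM.CMField.K F⟩ ι₁
    ⟨HodgeCM.HermSpace3.Hm V, HodgeCM.HermSpace3.isHermitian V, HodgeCM.HermSpace3.signature_ι₁ V, HodgeCM.HermSpace3.posDef_of_ne V⟩ Φ
/-- the TAIL OF THE REST OF RECORD at `μ` ([Liu21, Def. 4.5 (2), 4.16, Rem. 4.17]): `restTailOne id ι₁ hμ hw (ofPolDR …) (𝒯.rhoΩOne …)`. -/
local notation "𝔱⟦" h "," h6 "," F "," ι₁ "," V "," Φ "," μ "," hμ "," hw "⟧" =>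
  restTailOne (AlgHom.id ℚ _) ι₁ hμ hw (Def45.Carriers.ofPolDR μ (Def45.PolDR ι₁ hμ (Def45.RMuForm ι₁ hμ)))
    ((heckeTranslatesFamilyOf heckeTranslate_definedOver_holds h isoOf ⟨HodgeCM.CMField.K F⟩ ι₁
      ⟨HodgeCM.HermSpace3.Hm V, HodgeCM.HermSpace3.isHermitian V, HodgeCM.HermSpace3.signature_ι₁ V, HodgeCM.HermSpace3.posDef_of_ne V⟩ Φ
      h6).rhoΩOne (AlgHom.id ℚ _) ι₁ hμ hw (Def45.Carriers.ofPolDR μ (Def45.PolDR ι₁ hμ (Def45.RMuForm ι₁ hμ))))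
/-- the INDEX OF RECORD `LiuIndex.I V (repAt a₀) (muLiu ι₁ rep)` and its lines (port layer 69; the `h418` binder's enumeration). -/
local notation "𝕀⟦" V "," ι₁ "," a₀ "⟧" => I V (repAt a₀) (muLiu ι₁ GramClass.rep)
local notation "𝕃⟦" V "," ι₁ "," a₀ "⟧" => line V (repAt a₀) (muLiu ι₁ GramClass.rep)
/-- `ℙ i`: Liu's `τ′ ∈ Φ_μ` at the line (`PhiMuLine ι₁ (line i)`); `𝔾 i`: the GOOD lines = continuous pair splitting (else `block i = ⊥`). -/
local notation "ℙ⟦" V "," ι₁ "," a₀ "," i "⟧" => SplitLine.PhiMuLine ι₁ (line V (repAt a₀) (muLiu ι₁ GramClass.rep) i)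
local notation "𝔾⟦" V "," a₀ "," i "⟧" => Continuous (Subtype.val (Sigma.snd i) : SplittingAt V (repAt a₀ (Sigma.fst i)))
/-- the representative section of record at the index line `i` (re-points Def. 4.12's collection at the package's line `⟨u_{a_i}⟩`). -/
local notation "𝕣⟦" F "," a₀ "," i "⟧" =>
  Rep.update ↥(maximalRealSubfield (HodgeCM.CMField.K F)) (imagUnitSq (HodgeCM.CMField.K F))
    (Rep.ofLineOf ↥(maximalRealSubfield (HodgeCM.CMField.K F)) (imagUnitSq (HodgeCM.CMField.K F)))
    (locF ↥(maximalRealSubfield (HodgeCM.CMField.K F)) (imagUnitSq (HodgeCM.CMField.K F))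
      (realUnit ⟨HodgeCM.CMField.K F⟩ (repAt a₀ (Sigma.fst i)).1 (repAt a₀ (Sigma.fst i)).2.1 (repAt a₀ (Sigma.fst i)).2.2))
    (realUnit ⟨HodgeCM.CMField.K F⟩ (repAt a₀ (Sigma.fst i)).1 (repAt a₀ (Sigma.fst i)).2.1 (repAt a₀ (Sigma.fst i)).2.2) rfl
/-- the μ-UNIFORM WEIL CARRIERS OF RECORD at the index line `i` (own-htheta ✔ `Model.uniformOmegaRep` at `δ′ = (2δ_F)⁻¹`, section 𝕣). -/
local notation "𝕌⟦" h "," F "," ι₁ "," V "," Φ "," a₀ "," i "⟧" =>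
  uniformOmegaRep h ⟨HodgeCM.CMField.K F⟩ ι₁
    ⟨HodgeCM.HermSpace3.Hm V, HodgeCM.HermSpace3.isHermitian V, HodgeCM.HermSpace3.signature_ι₁ V, HodgeCM.HermSpace3.posDef_of_ne V⟩ Φ
    e₁ (frameD V) (frameD_real V) (frameD_ne V) (ιVE V) (2 * imagUnit (HodgeCM.CMField.K F))⁻¹ (fun _ _ => 𝕣⟦F, a₀, i⟧)
/-- LIU'S OWN δ′ REST OF RECORD at `(i, μ)`: F4's `restOfCharDeltaPrime` (δ′ = (2δ_F)⁻¹ EXACT) at `(e₁, frameD V, ιVE V, 𝕣 i)`; `= (𝕌 i).rest (restTailOne …)` (`rfl`). -/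
local notation "𝔯⟦" h "," h6 "," F "," ι₁ "," V "," Φ "," a₀ "," i "," μ "," hμ "," hw "⟧" =>
  restOfCharDeltaPrime h ⟨HodgeCM.CMField.K F⟩ h6 ι₁
    ⟨HodgeCM.HermSpace3.Hm V, HodgeCM.HermSpace3.isHermitian V, HodgeCM.HermSpace3.signature_ι₁ V, HodgeCM.HermSpace3.posDef_of_ne V⟩ Φ
    e₁ (frameD V) (frameD_real V) (frameD_ne V) (ιVE V) 𝕣⟦F, a₀, i⟧ μ hμ hw


/-! ## §P  The plug: END §A (end-1 v6) with (c)+(d) := the socket -/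


set_option synthInstance.maxHeartbeats 400000 in
set_option maxHeartbeats 8000000 in
/-- **§A The Δ2 bridge at the pinned dictionary of record** (`F` Galois CM, `6 ≤ [F:ℚ]`): `Thm418C` from the printed citations at the
CONSTRUCTED objects — per index line `i` with continuous pair splitting and conjugate-symplectic weight-one `μ`: `hLiu'` [Liu21, Thm 4.18] AS
PRINTED at Liu's own δ′ rest of record `restOfCharDeltaPrime … (2δ_F)⁻¹ 𝕣 μ …` (F4; `= (𝕌 i).rest (restTailOne …)` by `rfl`; READING r8), `h411` [Def 4.11], `h413`
[Prop 4.13] at the tower, `hμsep` [Lem D.1 (3)] cross-`μ` leg, `hD1'` [Lem D.1 (1)] per place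
— BY VALUE: `𝕌 i` (✔ `uniformOmegaRep` at δ′, section `𝕣 i`), `restTailOne …`, `Ks := Level.capThree C.S.K₀`, `hK := C.S.K₀`; BY NAME (DECISION #13): (b) the Ω-slot `hΩ`, `hbad`, (c) `M ∕ jH ∕ hjHinj ∕ hjH`, (d) `pieces`.  ONE application of ✔ `PinSignatures.thm418C_liuDictionaryPin_of_pins`;
its `h411 ∕ hsep` DERIVED (✔ `UniformOmega.adjectives_rhoAt_prop413Data_of_def411AsPrinted_rest` ∕ `…admTriple_eq_of_areIsomorphic_of_thm418AsPrinted_rest`).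
HC_CM is NOT proved here.  [cite: Liu2021, Thm. 4.18 (FJcycle.tex l. 2232–2245), Prop. 4.13 (l. 2113–2119), Def. 4.11, App. D Lem. D.1 (1),(3)]
[cite: GelbartRogawski1991, §3.1 Prop. 3.1.1 p. 455 L1–3, Remark p. 457 L4–13] -/
theorem thm418C_indexOfRecord_of_socket (F : HodgeCM.CMField) [IsGalois ℚ (F : Type)] (h6 : 6 ≤ Module.finrank ℚ (F : Type))
    {ι₁ : (F : Type) →+* ℂ} (V : HodgeCM.HermSpace3 F ι₁) (a₀ : RealScalar F) (h : exists_recordSystem)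
    (Φ : CMType (F : Type))
    -- PIN by name: block vanishing off the index lines with continuous pair splitting (✔ p370342 `Item6PinBlockVanishing` + p371180, oleans owed)
    (hbad : ∀ (i : 𝕀⟦V, ι₁, a₀⟧), ℙ⟦V, ι₁, a₀, i⟧ → ¬ 𝔾⟦V, a₀, i⟧ → (𝔇⟦V, ι₁, a₀⟧).block i = ⊥)
    -- (b) PIN by name: the Ω-slot at the index of record (prove-7 `LiuIndex.OmegaPin.exists_pinTerms_indexOfRecord`, behind prove-6 ∕ F4 ∕ pin-3)
    (hΩ : ∃ (μ : ∀ i : 𝕀⟦V, ι₁, a₀⟧, ℙ⟦V, ι₁, a₀, i⟧ → 𝔾⟦V, a₀, i⟧ → (Literature.NumberTheory.Automorphic.IdeleClassGroup (F : Type) →ₜ* Circle))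
      (hμ : ∀ (i : 𝕀⟦V, ι₁, a₀⟧) (hi : ℙ⟦V, ι₁, a₀, i⟧) (hg : 𝔾⟦V, a₀, i⟧), IdeleClassGroup.IsConjugateSymplectic (F : Type) (μ i hi hg))
      (hw : ∀ (i : 𝕀⟦V, ι₁, a₀⟧) (hi : ℙ⟦V, ι₁, a₀, i⟧) (hg : 𝔾⟦V, a₀, i⟧), IdeleClassGroup.HasWeight (F : Type) (μ i hi hg) 1)
      (σ : ∀ (i : 𝕀⟦V, ι₁, a₀⟧) (hi : ℙ⟦V, ι₁, a₀, i⟧) (hg : 𝔾⟦V, a₀, i⟧), {χ : (𝕃⟦V, ι₁, a₀⟧ i).CharW // (𝕃⟦V, ι₁, a₀⟧ i).IsAutChar χ} → (toThm418Data _ ((𝕌⟦h, F, ι₁, V, Φ, a₀, i⟧).rest 𝔱⟦h, h6, F, ι₁, V, Φ, μ i hi hg, hμ i hi hg, hw i hi hg⟧)).AdmIndex)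
      (e : ∀ (i : 𝕀⟦V, ι₁, a₀⟧) (hi : ℙ⟦V, ι₁, a₀, i⟧) (hg : 𝔾⟦V, a₀, i⟧) (a : {χ : (𝕃⟦V, ι₁, a₀⟧ i).CharW // (𝕃⟦V, ι₁, a₀⟧ i).IsAutChar χ}), (𝕃⟦V, ι₁, a₀⟧ i).Ω (ιVE V) a.1 ≃ₗ[ℂ] (toThm418Data _ ((𝕌⟦h, F, ι₁, V, Φ, a₀, i⟧).rest 𝔱⟦h, h6, F, ι₁, V, Φ, μ i hi hg, hμ i hi hg, hw i hi hg⟧)).omegaAt (σ i hi hg a)),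
      (∀ (i : 𝕀⟦V, ι₁, a₀⟧) (hi : ℙ⟦V, ι₁, a₀, i⟧) (hg : 𝔾⟦V, a₀, i⟧), IdeleClassGroup.HasCMType (F : Type) (μ i hi hg) (𝕃⟦V, ι₁, a₀⟧ i).lineType) ∧ (∀ (i : 𝕀⟦V, ι₁, a₀⟧) (hi : ℙ⟦V, ι₁, a₀, i⟧) (hg : 𝔾⟦V, a₀, i⟧), Function.Injective (σ i hi hg)) ∧
      (∀ (i : 𝕀⟦V, ι₁, a₀⟧) (hi : ℙ⟦V, ι₁, a₀, i⟧) (hg : 𝔾⟦V, a₀, i⟧) (a : {χ : (𝕃⟦V, ι₁, a₀⟧ i).CharW // (𝕃⟦V, ι₁, a₀⟧ i).IsAutChar χ}) (g : ↥V.adelicFin) (m : (𝕃⟦V, ι₁, a₀⟧ i).Ω (ιVE V) a.1),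
          e i hi hg a (MonoidAlgebra.of ℂ ↥V.adelicFin g • m) = (toThm418Data _ ((𝕌⟦h, F, ι₁, V, Φ, a₀, i⟧).rest 𝔱⟦h, h6, F, ι₁, V, Φ, μ i hi hg, hμ i hi hg, hw i hi hg⟧)).rhoAt (σ i hi hg a) g (e i hi hg a m)))
    -- [Liu21, Thm 4.18] AS PRINTED at the rests of record = F4's `restOfCharDeltaPrime … (2δ_F)⁻¹ 𝕣 μ …` (Liu's own δ′ rest; `= (𝕌 i).rest (restTailOne …)` by `rfl`) — a READING r8
    (hLiu' : ∀ (i : 𝕀⟦V, ι₁, a₀⟧) (μ : Literature.NumberTheory.Automorphic.IdeleClassGroup (F : Type) →ₜ* Circle)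
      (hμ : IdeleClassGroup.IsConjugateSymplectic (F : Type) μ) (hw : IdeleClassGroup.HasWeight (F : Type) μ 1),
      Thm418AsPrinted (toThm418Data _ 𝔯⟦h, h6, F, ι₁, V, Φ, a₀, i, μ, hμ, hw⟧))
    -- [Liu21, Def 4.11] AS PRINTED at the rests of record
    (h411 : ∀ (i : 𝕀⟦V, ι₁, a₀⟧) (μ : Literature.NumberTheory.Automorphic.IdeleClassGroup (F : Type) →ₜ* Circle)
      (hμ : IdeleClassGroup.IsConjugateSymplectic (F : Type) μ) (hw : IdeleClassGroup.HasWeight (F : Type) μ 1),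
      Def411AsPrinted (toThm418Data _ 𝔯⟦h, h6, F, ι₁, V, Φ, a₀, i, μ, hμ, hw⟧))
    -- [Liu21, Prop 4.13] AS PRINTED at the tower `(𝔇).H` over the uniform carriers of the line
    (h413 : ∀ (i : 𝕀⟦V, ι₁, a₀⟧), Prop413AsPrinted ((𝕌⟦h, F, ι₁, V, Φ, a₀, i⟧).prop413Data (𝔇⟦V, ι₁, a₀⟧).H))
    -- the cross-μ leg of [Liu21, App. D Lem D.1 (3)] («μ = ⊗_v μ_v»): isomorphic non-zero summands have the same μ
    (hμsep : ∀ (i : 𝕀⟦V, ι₁, a₀⟧) (s t : ((𝕌⟦h, F, ι₁, V, Φ, a₀, i⟧).prop413Data (𝔇⟦V, ι₁, a₀⟧).H).AdmTriple), Nontrivial (((𝕌⟦h, F, ι₁, V, Φ, a₀, i⟧).prop413Data (𝔇⟦V, ι₁, a₀⟧).H).omegaAt s) →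
      (∃ f : ((𝕌⟦h, F, ι₁, V, Φ, a₀, i⟧).prop413Data (𝔇⟦V, ι₁, a₀⟧).H).omegaAt s ≃ₗ[ℂ] ((𝕌⟦h, F, ι₁, V, Φ, a₀, i⟧).prop413Data (𝔇⟦V, ι₁, a₀⟧).H).omegaAt t,
        ∀ (g : ↥V.adelicFin) (v : ((𝕌⟦h, F, ι₁, V, Φ, a₀, i⟧).prop413Data (𝔇⟦V, ι₁, a₀⟧).H).omegaAt s), f (((𝕌⟦h, F, ι₁, V, Φ, a₀, i⟧).prop413Data (𝔇⟦V, ι₁, a₀⟧).H).rhoAt s g v) = ((𝕌⟦h, F, ι₁, V, Φ, a₀, i⟧).prop413Data (𝔇⟦V, ι₁, a₀⟧).H).rhoAt t g (f v)) → s.1.μ = t.1.μ)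
    -- [Liu21, App. D Lem D.1 (1)] AS PRINTED per place at the local data of the rests of record (F4's `hD1` shape, 𝕌-currency; gives `ω ≠ 0` via §A0)
    (hD1' : ∀ (i : 𝕀⟦V, ι₁, a₀⟧) (μ : Literature.NumberTheory.Automorphic.IdeleClassGroup (F : Type) →ₜ* Circle)
      (hμ : IdeleClassGroup.IsConjugateSymplectic (F : Type) μ) (hw : IdeleClassGroup.HasWeight (F : Type) μ 1) (hΦμ : IdeleClassGroup.HasCMType (F : Type) μ (𝕃⟦V, ι₁, a₀⟧ i).lineType)
      (j : (toThm418Data _ 𝔯⟦h, h6, F, ι₁, V, Φ, a₀, i, μ, hμ, hw⟧).AdmIndex) (v : IsDedekindDomain.HeightOneSpectrum (𝓞 ↥(maximalRealSubfield (F : Type)))),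
      LemD1_1AsPrinted
        (Def411WeilCarriers.localLemD1Data ↥(maximalRealSubfield (F : Type)) (F : Type) (IsCMField.complexConj (F : Type)) 3 e₁
          (Matrix.diagonal (frameD V)) (complexConj_imagUnit (F : Type)) (imagUnit_ne_zero (F : Type)) (imagUnit_mul_self (F : Type))
          (realDiagonal_isSymm (F : Type) (frameD V) (frameD_real V)) (isUnit_det_realDiagonal (F : Type) (frameD V) (frameD_real V) (frameD_ne V))
          (realDiagonal_map (F : Type) (frameD V) (frameD_real V)).symm ((𝕣⟦F, a₀, i⟧).toFun j.1.1)
          (OmegaChiSplitting.chiLocalSplittingsD ⟨HodgeCM.CMField.K F⟩ e₁ (frameD V) (frameD_real V) (frameD_ne V) (toHeckeCharacter (F : Type) μ)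
            ((isOscillatorChar_toHeckeCharacter_iff μ).mpr hμ) ((𝕣⟦F, a₀, i⟧).toFun j.1.1))
          (le_refl 3) (localMu (F : Type) (toHeckeCharacter (F : Type) μ))
          (fun v x => norm_localMu (F : Type) (toHeckeCharacter (F : Type) μ) v (isUnitary_toHeckeCharacter (F : Type) μ) x)
          (continuous_localMu (F : Type) (toHeckeCharacter (F : Type) μ))
          (fun v t => localMu_toLocalRing_eq_one_iff (F : Type) (toHeckeCharacter (F : Type) μ) v ((isOscillatorChar_toHeckeCharacter_iff μ).mpr hμ) t)
          j.1.2.1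
          (Def411WeilCarriers.norm_chi_eq_one ↥(maximalRealSubfield (F : Type)) (F : Type) (IsCMField.complexConj (F : Type))
            (Algebra.IsQuadraticExtension.finrank_eq_two ↥(maximalRealSubfield (F : Type)) (F : Type))
            (UnitaryGroup.algEquiv_ne_one_of_apply_eq_neg ↥(maximalRealSubfield (F : Type)) (F : Type) (IsCMField.complexConj (F : Type))
              (complexConj_imagUnit (F : Type)) (imagUnit_ne_zero (F : Type))) j.1.2)
          j.1.2.2.1 v))
    -- (c)+(d) THE SOCKET: the J record and the pieces — ONE value (`SocketCD`, keyed form), plugged by any route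
    (S : SocketCD F h6 V a₀ h Φ) :
    (𝔇⟦V, ι₁, a₀⟧).Thm418C := by
  -- F4's δ′ rest of record IS the rest assembled from the uniform carriers and the one-object tail (own-htheta ✔ `restOfCharRep_eq_rest`, `rfl`)
  have eR : ∀ (i : 𝕀⟦V, ι₁, a₀⟧) (μ : Literature.NumberTheory.Automorphic.IdeleClassGroup (F : Type) →ₜ* Circle)
      (hμ : IdeleClassGroup.IsConjugateSymplectic (F : Type) μ) (hw : IdeleClassGroup.HasWeight (F : Type) μ 1),
      𝔯⟦h, h6, F, ι₁, V, Φ, a₀, i, μ, hμ, hw⟧ = (𝕌⟦h, F, ι₁, V, Φ, a₀, i⟧).rest 𝔱⟦h, h6, F, ι₁, V, Φ, μ, hμ, hw⟧ := fun i μ hμ hw =>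
    restOfCharRep_eq_rest h ⟨HodgeCM.CMField.K F⟩ ι₁ ⟨HodgeCM.HermSpace3.Hm V, HodgeCM.HermSpace3.isHermitian V, HodgeCM.HermSpace3.signature_ι₁ V, HodgeCM.HermSpace3.posDef_of_ne V⟩ Φ
      e₁ (frameD V) (frameD_real V) (frameD_ne V) (ιVE V) (2 * imagUnit (F : Type))⁻¹ (fun _ _ => 𝕣⟦F, a₀, i⟧) h6 μ hμ hw
  -- the displayed cites, moved from Liu's δ′ rest to the pin theorem's currency along `eR` (transport of a `Prop`, no re-typing)
  have hLiuU : ∀ (i : 𝕀⟦V, ι₁, a₀⟧) (μ : Literature.NumberTheory.Automorphic.IdeleClassGroup (F : Type) →ₜ* Circle)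
      (hμ : IdeleClassGroup.IsConjugateSymplectic (F : Type) μ) (hw : IdeleClassGroup.HasWeight (F : Type) μ 1),
      Thm418AsPrinted (toThm418Data _ ((𝕌⟦h, F, ι₁, V, Φ, a₀, i⟧).rest 𝔱⟦h, h6, F, ι₁, V, Φ, μ, hμ, hw⟧)) := fun i μ hμ hw => eR i μ hμ hw ▸ hLiu' i μ hμ hw
  have h411U : ∀ (i : 𝕀⟦V, ι₁, a₀⟧) (μ : Literature.NumberTheory.Automorphic.IdeleClassGroup (F : Type) →ₜ* Circle)
      (hμ : IdeleClassGroup.IsConjugateSymplectic (F : Type) μ) (hw : IdeleClassGroup.HasWeight (F : Type) μ 1),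
      Def411AsPrinted (toThm418Data _ ((𝕌⟦h, F, ι₁, V, Φ, a₀, i⟧).rest 𝔱⟦h, h6, F, ι₁, V, Φ, μ, hμ, hw⟧)) := fun i μ hμ hw => eR i μ hμ hw ▸ h411 i μ hμ hw
  -- [Lem D.1 (1)] ⇒ `ω ≠ 0` (F4 ✔ `nontrivial_omegaAt_restOfCharDeltaPrime_of_lemD1AsPrinted`; `ιVE V` onto, `n = 3`), moved along `eR`
  have hnvU : ∀ (i : 𝕀⟦V, ι₁, a₀⟧) (μ : Literature.NumberTheory.Automorphic.IdeleClassGroup (F : Type) →ₜ* Circle)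
      (hμ : IdeleClassGroup.IsConjugateSymplectic (F : Type) μ) (hw : IdeleClassGroup.HasWeight (F : Type) μ 1) (hΦμ : IdeleClassGroup.HasCMType (F : Type) μ (𝕃⟦V, ι₁, a₀⟧ i).lineType),
      ∀ j : (toThm418Data _ ((𝕌⟦h, F, ι₁, V, Φ, a₀, i⟧).rest 𝔱⟦h, h6, F, ι₁, V, Φ, μ, hμ, hw⟧)).AdmIndex, Nontrivial ((toThm418Data _ ((𝕌⟦h, F, ι₁, V, Φ, a₀, i⟧).rest 𝔱⟦h, h6, F, ι₁, V, Φ, μ, hμ, hw⟧)).omegaAt j) := fun i μ hμ hw hΦμ =>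
    eR i μ hμ hw ▸ fun j => nontrivial_omegaAt_restOfCharDeltaPrime_of_lemD1AsPrinted h ⟨HodgeCM.CMField.K F⟩ h6 ι₁
      ⟨HodgeCM.HermSpace3.Hm V, HodgeCM.HermSpace3.isHermitian V, HodgeCM.HermSpace3.signature_ι₁ V, HodgeCM.HermSpace3.posDef_of_ne V⟩ Φ e₁ (frameD V)
      (frameD_real V) (frameD_ne V) (ιVE V) 𝕣⟦F, a₀, i⟧ μ hμ hw
      (UnitaryDualPair.finPart_cmKTypeHom_finAdelicToAdelic_surjective (F : Type) V.Hm (frameG V) (frameD V) (frame_congr V)) (le_refl 3) j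
      (hD1' i μ hμ hw hΦμ j)
  obtain ⟨μ, hμ, hw, σ, e, hcm, hσ, he⟩ := hΩ
  exact Summit.HodgeConjecture.CorCM.D2Bridge.PinSignatures.thm418C_liuDictionaryPin_of_pins V (𝕀⟦V, ι₁, a₀⟧) (𝕃⟦V, ι₁, a₀⟧) h Φ
    ℭ⟦h, F, ι₁, V, Φ⟧ (fun i => Continuous (i.2.1 : SplittingAt V (repAt a₀ i.1)))
    hbad
    (fun i _ _ => 𝕌⟦h, F, ι₁, V, Φ, a₀, i⟧)
    (fun i hi hg => (𝕌⟦h, F, ι₁, V, Φ, a₀, i⟧).rest 𝔱⟦h, h6, F, ι₁, V, Φ, μ i hi hg, hμ i hi hg, hw i hi hg⟧)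
    (fun i hi hg => 𝔱⟦h, h6, F, ι₁, V, Φ, μ i hi hg, hμ i hi hg, hw i hi hg⟧)
    (fun i hi hg => hLiuU i (μ i hi hg) (hμ i hi hg) (hw i hi hg)) σ hσ e he
    (fun i hi hg => S.M i (μ i hi hg) (hμ i hi hg) (hw i hi hg) (hcm i hi hg))
    (fun i hi hg => S.jH i (μ i hi hg) (hμ i hi hg) (hw i hi hg) (hcm i hi hg))
    (fun i hi hg => S.hjHinj i (μ i hi hg) (hμ i hi hg) (hw i hi hg) (hcm i hi hg))
    (fun i hi hg => S.hjH i (μ i hi hg) (hμ i hi hg) (hw i hi hg) (hcm i hi hg))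
    (fun _ => HodgeCM.Level.capThree (V := V) ((ℭ⟦h, F, ι₁, V, Φ⟧).S.K₀.1 : Subgroup ↥V.adelicFin) (ℭ⟦h, F, ι₁, V, Φ⟧).S.K₀.2.1)
    (fun i hi hg K hK => S.pieces i (μ i hi hg) (hμ i hi hg) (hw i hi hg) (hcm i hi hg) K hK)
    (fun i hi hg j => hnvU i (μ i hi hg) (hμ i hi hg) (hw i hi hg) (hcm i hi hg) j)
    (fun i _ _ => h413 i)
    (fun i _ _ => (𝕌⟦h, F, ι₁, V, Φ, a₀, i⟧).adjectives_rhoAt_prop413Data_of_def411AsPrinted_rest _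
      (fun μ hμ hw => 𝔱⟦h, h6, F, ι₁, V, Φ, μ, hμ, hw⟧) (h411U i))
    (fun i _ _ => (𝕌⟦h, F, ι₁, V, Φ, a₀, i⟧).admTriple_eq_of_areIsomorphic_of_thm418AsPrinted_rest _
      (fun μ hμ hw => 𝔱⟦h, h6, F, ι₁, V, Φ, μ, hμ, hw⟧) (hLiuU i) (hμsep i))
    ⟨(ℭ⟦h, F, ι₁, V, Φ⟧).S.K₀.1, (ℭ⟦h, F, ι₁, V, Φ⟧).S.K₀.2⟩

end Summit.HodgeConjecture.CorCM.D2Bridge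

end
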